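import Literature.Probability.Process.GaussianTaylorStep
import Mathlib.Analysis.SpecialFunctions.Sqrt
import Mathlib.Analysis.SpecialFunctions.Pow.Deriv
import HarnessLib

/-!
# The Newtonian potential `1/|w|` of the last three coordinates of `ℝ⁴` is harmonic off the axis

Topic `Probability/Process` (support for the transience of three-dimensional Brownian motion seen
inside the four-dimensional one, `BrownianVecTransience`, and for [LSW] Prop. 4.1). On
`ℝ⁴ = Fin 4 → ℝ` write `v = (x, w)` with `x = v 0` and `w = (v 1, v 2, v 3)`; put
`spSq v = ∑_{i=1}^{3} (v i)²`, `spRad v = √(spSq v) = |w|` and `newton v = |w|⁻¹`. We prove that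
`newton` is `C²` on the open set `{|w| ≠ 0}` and that its Laplacian (`lap` of
`GaussianTaylorStep`: the trace of `fderiv (fderiv ·)`) vanishes there
(`lap_newton_eq_zero`), by computing second derivatives along coordinate lines
(`hess_apply_eq_of_line`: `D²f(y)(w, w)` is the second derivative of `t ↦ f(y + tw)`) and the
one-variable identities for `t ↦ (c + 2bt + t²)^{-1/2}`. Le Gall (2016), Ch. 7, Lemma 7.12
(radial harmonic functions: `a + b|x|^{2−d}`), here `d = 3`. Everything is proved.

## References

* J.-F. Le Gall, *Brownian Motion, Martingales, and Stochastic Calculus*, GTM 274 (2016), Ch. 7,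
  Lemma 7.12. [Legall2016]
-/

noncomputable section

open Filter Topology Set Finset
open scoped BigOperators

namespace Literature.Probability.Process

/-! ### Second derivatives along lines -/

variable {d : ℕ}

/-- **`D²f(y)(w, w)` is the second derivative of `t ↦ f(y + tw)` at `0`**: if `f` is `C²` on an
open set `U ∋ y`, `t ↦ f(y + tw)` has derivative `D₁ t` for `t` near `0` and `D₁` has derivative
`L` at `0`, then `hess f y w w = L`. [folklore] -/
theorem hess_apply_eq_of_line {f : (Fin d → ℝ) → ℝ} {U : Set (Fin d → ℝ)} (hU : IsOpen U)
    (hf : ContDiffOn ℝ 2 f U) {y : Fin d → ℝ} (hy : y ∈ U) (w : Fin d → ℝ) {D₁ : ℝ → ℝ} {L : ℝ}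
    (hD₁ : ∀ᶠ t in 𝓝 (0 : ℝ), HasDerivAt (fun s : ℝ ↦ f (y + s • w)) (D₁ t) t)
    (hL : HasDerivAt D₁ L 0) : hess f y w w = L := by
  set γ : ℝ → (Fin d → ℝ) := fun t ↦ y + t • w with hγdef
  have hγ : ∀ t, HasDerivAt γ w t := fun t ↦ by
    have := ((hasDerivAt_id t).smul_const w).const_add y
    simpa [hγdef] using this
  have hγ0 : γ 0 = y := by simp [hγdef]
  have hγc : Continuous γ := continuous_const.add (continuous_id.smul continuous_const)
  -- `γ t ∈ U` for `t` near `0`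
  have hγU : ∀ᶠ t in 𝓝 (0 : ℝ), γ t ∈ U := hγc.continuousAt.preimage_mem_nhds (by rw [hγ0]; exact hU.mem_nhds hy)
  -- `f` is differentiable on `U`, with `fderiv` differentiable at `y` with derivative `hess f y`
  have hdiff : ∀ z ∈ U, HasFDerivAt f (fderiv ℝ f z) z := fun z hz ↦
    ((hf.differentiableOn (by norm_num)).differentiableAt (hU.mem_nhds hz)).hasFDerivAt
  have hfy : ContDiffAt ℝ 2 f y := hf.contDiffAt (hU.mem_nhds hy)
  have hfd : HasFDerivAt (fderiv ℝ f) (hess f y) y :=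
    (((hfy.fderiv_right (m := 1) (by norm_num)).differentiableAt (by norm_num))).hasFDerivAt
  -- the line derivative is `fderiv f (γ t) w` near `0`
  have hline : ∀ᶠ t in 𝓝 (0 : ℝ), D₁ t = fderiv ℝ f (γ t) w := by
    filter_upwards [hγU, hD₁] with t htU htD
    exact htD.unique ((hdiff _ htU).comp_hasDerivAt t (hγ t))
  -- differentiate `t ↦ fderiv f (γ t) w` at `0`
  have h2 : HasDerivAt (fun t ↦ fderiv ℝ f (γ t) w) (hess f y w w) 0 := by
    have hfd' : HasFDerivAt (fderiv ℝ f) (hess f y) (γ 0) := by rw [hγ0]; exact hfd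
    have h1 : HasDerivAt (fun s ↦ fderiv ℝ f (γ s)) (hess f y w) 0 :=
      hfd'.comp_hasDerivAt (0 : ℝ) (hγ 0)
    have h3 := h1.clm_apply (hasDerivAt_const (0 : ℝ) w)
    simpa using h3
  exact (hL.unique (h2.congr_of_eventuallyEq hline)).symm

/-! ### The spatial radius and the Newtonian potential on `ℝ⁴` -/

/-- `|w|² = (v 1)² + (v 2)² + (v 3)²`, the squared norm of the last three coordinates. [folklore] -/
def spSq (v : Fin 4 → ℝ) : ℝ := v 1 ^ 2 + v 2 ^ 2 + v 3 ^ 2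

/-- `|w| = √(|w|²)`. [folklore] -/
def spRad (v : Fin 4 → ℝ) : ℝ := Real.sqrt (spSq v)

/-- **The Newtonian potential** `|w|⁻¹` of the spatial part. [cite: Legall2016, Ch. 7 Lemma 7.12] -/
def newton (v : Fin 4 → ℝ) : ℝ := (spRad v)⁻¹

/-- `|w|² ≥ 0`. [folklore] -/
theorem spSq_nonneg (v : Fin 4 → ℝ) : 0 ≤ spSq v := by unfold spSq; positivity

/-- `|w| ≥ 0`. [folklore] -/
theorem spRad_nonneg (v : Fin 4 → ℝ) : 0 ≤ spRad v := Real.sqrt_nonneg _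

/-- `|w|² = (|w|)²`. [folklore] -/
theorem spRad_sq (v : Fin 4 → ℝ) : spRad v ^ 2 = spSq v := Real.sq_sqrt (spSq_nonneg v)

/-- `|w|⁻¹ ≥ 0`. [folklore] -/
theorem newton_nonneg (v : Fin 4 → ℝ) : 0 ≤ newton v := inv_nonneg.2 (spRad_nonneg v)

/-- `|w|²` is smooth. [folklore] -/
theorem contDiff_spSq {n : WithTop ℕ∞} : ContDiff ℝ n spSq := by
  unfold spSq
  exact (((contDiff_apply ℝ ℝ (1 : Fin 4)).pow 2).add ((contDiff_apply ℝ ℝ (2 : Fin 4)).pow 2)).add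
    ((contDiff_apply ℝ ℝ (3 : Fin 4)).pow 2)

/-- `|w|²` is continuous. [folklore] -/
theorem continuous_spSq : Continuous spSq := contDiff_spSq.continuous (n := 0)

/-- `|w|` is continuous. [folklore] -/
theorem continuous_spRad : Continuous spRad := continuous_spSq.sqrt

/-- The region `{|w| ≠ 0}` off the axis. [folklore] -/
def offAxis : Set (Fin 4 → ℝ) := {v | spSq v ≠ 0}

/-- The off-axis region is open. [folklore] -/
theorem isOpen_offAxis : IsOpen offAxis := isOpen_ne_fun continuous_spSq continuous_const

/-- Off the axis iff `|w| > 0`. [folklore] -/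
theorem mem_offAxis_iff_spRad_pos {v : Fin 4 → ℝ} : v ∈ offAxis ↔ 0 < spRad v := by
  rw [offAxis, mem_setOf_eq, spRad, Real.sqrt_pos]
  exact ⟨fun h ↦ lt_of_le_of_ne (spSq_nonneg v) (Ne.symm h), fun h ↦ h.ne'⟩

/-- `|w| > 0` off the axis. [folklore] -/
theorem spRad_pos_of_mem {v : Fin 4 → ℝ} (hv : v ∈ offAxis) : 0 < spRad v :=
  mem_offAxis_iff_spRad_pos.1 hv

/-- **`|w|⁻¹` is `C²` (indeed smooth) off the axis.** [folklore] -/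
theorem contDiffOn_newton : ContDiffOn ℝ 2 newton offAxis := fun v hv ↦ by
  have hpos : 0 < spSq v := lt_of_le_of_ne (spSq_nonneg v) (Ne.symm hv)
  have h1 : ContDiffAt ℝ 2 (fun u ↦ Real.sqrt (spSq u)) v :=
    (Real.contDiffAt_sqrt hpos.ne').comp v contDiff_spSq.contDiffAt
  have h2 : ContDiffAt ℝ 2 (fun u ↦ (Real.sqrt (spSq u))⁻¹) v :=
    (contDiffAt_inv ℝ (Real.sqrt_pos.2 hpos).ne').comp v h1
  exact h2.contDiffWithinAt

/-! ### One-variable calculus: `t ↦ (c + 2bt + t²)^{-1/2}` -/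

section OneVar

variable {c b : ℝ}

/-- The quadratic `p(t) = c + 2bt + t²` and its derivative. [folklore] -/
theorem hasDerivAt_quad (c b t : ℝ) : HasDerivAt (fun t : ℝ ↦ c + 2 * b * t + t ^ 2) (2 * b + 2 * t) t := by
  have h := (((hasDerivAt_id t).const_mul (2 * b)).const_add c).fun_add (hasDerivAt_pow 2 t)
  refine h.congr_deriv ?_
  simp

/-- First derivative of `(√p)⁻¹`: `−(b + t)/(p √p)` wherever `p(t) > 0`. [folklore] -/
theorem hasDerivAt_inv_sqrt_quad {t : ℝ} (hp : 0 < c + 2 * b * t + t ^ 2) :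
    HasDerivAt (fun s : ℝ ↦ (Real.sqrt (c + 2 * b * s + s ^ 2))⁻¹)
      (-(b + t) / ((c + 2 * b * t + t ^ 2) * Real.sqrt (c + 2 * b * t + t ^ 2))) t := by
  have hs : Real.sqrt (c + 2 * b * t + t ^ 2) ≠ 0 := (Real.sqrt_pos.2 hp).ne'
  have h1 := ((hasDerivAt_quad c b t).sqrt hp.ne').fun_inv hs
  refine h1.congr_deriv ?_
  rw [Real.sq_sqrt hp.le]
  field_simp

/-- Second derivative at `0`: the derivative of `t ↦ −(b + t)/(p √p)` at `t = 0` is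
`−1/(c √c) + 3b²/(c² √c)` (`c > 0`). [folklore] -/
theorem hasDerivAt_lineDeriv_zero (hc : 0 < c) :
    HasDerivAt (fun t : ℝ ↦ -(b + t) / ((c + 2 * b * t + t ^ 2) * Real.sqrt (c + 2 * b * t + t ^ 2)))
      (-1 / (c * Real.sqrt c) + 3 * b ^ 2 / (c ^ 2 * Real.sqrt c)) 0 := by
  -- write `c = s²`, `s > 0`
  obtain ⟨s, hspos, hcs⟩ : ∃ s : ℝ, 0 < s ∧ s ^ 2 = c := ⟨Real.sqrt c, Real.sqrt_pos.2 hc, Real.sq_sqrt hc.le⟩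
  subst hcs
  have hsr : Real.sqrt (s ^ 2) = s := Real.sqrt_sq hspos.le
  have hnum : HasDerivAt (fun t : ℝ ↦ -(b + t)) (-(1 : ℝ)) 0 := ((hasDerivAt_id (0 : ℝ)).const_add b).fun_neg
  have hp0 : s ^ 2 + 2 * b * 0 + 0 ^ 2 = s ^ 2 := by ring
  have hp0' : (s ^ 2 + 2 * b * 0 + 0 ^ 2) ≠ 0 := by rw [hp0]; positivity
  have hsqrt := (hasDerivAt_quad (s ^ 2) b 0).sqrt hp0'
  have hden := (hasDerivAt_quad (s ^ 2) b 0).fun_mul hsqrt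
  have hden0 : (s ^ 2 + 2 * b * 0 + 0 ^ 2) * Real.sqrt (s ^ 2 + 2 * b * 0 + 0 ^ 2) ≠ 0 := by
    rw [hp0, hsr]; positivity
  have h := hnum.fun_div hden hden0
  refine h.congr_deriv ?_
  simp only [hp0, hsr]
  field_simp
  ring

end OneVar

/-! ### `Δ |w|⁻¹ = 0` off the axis -/

/-- Moving along `e₀` does not change the spatial part. [folklore] -/
theorem spSq_add_smul_bvec_zero (v : Fin 4 → ℝ) (t : ℝ) : spSq (v + t • bvec 0) = spSq v := by
  simp [spSq, bvec]

/-- Moving along `eᵢ`, `i ∈ {1, 2, 3}`: `|w|²` becomes the quadratic `|w|² + 2 t vᵢ + t²`. [folklore] -/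
theorem spSq_add_smul_bvec (v : Fin 4 → ℝ) (t : ℝ) {i : Fin 4} (hi : i ≠ 0) :
    spSq (v + t • bvec i) = spSq v + 2 * v i * t + t ^ 2 := by
  fin_cases i
  · exact absurd rfl hi
  all_goals simp [spSq, bvec]; ring

/-- The diagonal Hessian entry along `e₀` vanishes. [folklore] -/
theorem hess_newton_zero {v : Fin 4 → ℝ} (hv : v ∈ offAxis) : hess newton v (bvec 0) (bvec 0) = 0 := by
  refine hess_apply_eq_of_line isOpen_offAxis contDiffOn_newton hv (bvec 0) (D₁ := fun _ ↦ 0) ?_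
    (hasDerivAt_const _ _)
  refine Eventually.of_forall fun t ↦ ?_
  have : (fun s : ℝ ↦ newton (v + s • bvec 0)) = fun _ ↦ newton v := by
    funext s; simp [newton, spRad, spSq_add_smul_bvec_zero]
  rw [this]
  exact hasDerivAt_const _ _

/-- The diagonal Hessian entries along `eᵢ`, `i ∈ {1, 2, 3}`. [folklore] -/
theorem hess_newton_of_ne_zero {v : Fin 4 → ℝ} (hv : v ∈ offAxis) {i : Fin 4} (hi : i ≠ 0) :
    hess newton v (bvec i) (bvec i) =
      -1 / (spSq v * Real.sqrt (spSq v)) + 3 * (v i) ^ 2 / (spSq v ^ 2 * Real.sqrt (spSq v)) := by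
  have hc : 0 < spSq v := lt_of_le_of_ne (spSq_nonneg v) (Ne.symm hv)
  refine hess_apply_eq_of_line isOpen_offAxis contDiffOn_newton hv (bvec i)
    (D₁ := fun t ↦ -(v i + t) / ((spSq v + 2 * v i * t + t ^ 2) * Real.sqrt (spSq v + 2 * v i * t + t ^ 2)))
    ?_ (hasDerivAt_lineDeriv_zero hc)
  -- near `0` the quadratic stays positive
  have hcont : Continuous fun t : ℝ ↦ spSq v + 2 * v i * t + t ^ 2 := by fun_prop
  have hev : ∀ᶠ t in 𝓝 (0 : ℝ), 0 < spSq v + 2 * v i * t + t ^ 2 :=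
    hcont.continuousAt.eventually (isOpen_Ioi.mem_nhds (by simpa using hc) : Ioi (0 : ℝ) ∈ 𝓝 (spSq v + 2 * v i * 0 + 0 ^ 2))
  filter_upwards [hev] with t ht
  have heq : (fun s : ℝ ↦ newton (v + s • bvec i)) = fun s ↦ (Real.sqrt (spSq v + 2 * v i * s + s ^ 2))⁻¹ := by
    funext s; simp [newton, spRad, spSq_add_smul_bvec v s hi]
  rw [heq]
  exact hasDerivAt_inv_sqrt_quad ht

/-- **`Δ |w|⁻¹ = 0` off the axis** (the Newtonian potential of `ℝ³` is harmonic; Le Gall (2016)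
Lemma 7.12 with `d = 3`). [cite: Legall2016, Ch. 7 Lemma 7.12] -/
theorem lap_newton_eq_zero {v : Fin 4 → ℝ} (hv : v ∈ offAxis) : lap newton v = 0 := by
  have hc : 0 < spSq v := lt_of_le_of_ne (spSq_nonneg v) (Ne.symm hv)
  have hs : Real.sqrt (spSq v) ≠ 0 := (Real.sqrt_pos.2 hc).ne'
  rw [lap, Fin.sum_univ_four, hess_newton_zero hv, hess_newton_of_ne_zero hv (by decide : (1 : Fin 4) ≠ 0),
    hess_newton_of_ne_zero hv (by decide : (2 : Fin 4) ≠ 0),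
    hess_newton_of_ne_zero hv (by decide : (3 : Fin 4) ≠ 0)]
  have hsum : v 1 ^ 2 + v 2 ^ 2 + v 3 ^ 2 = spSq v := rfl
  field_simp
  nlinarith [hsum]

/-- `|w|⁻¹ ≤ ε⁻¹` where `|w| ≥ ε > 0`. [folklore] -/
theorem newton_le_inv {v : Fin 4 → ℝ} {ε : ℝ} (hε : 0 < ε) (hv : ε ≤ spRad v) : newton v ≤ ε⁻¹ :=
  inv_anti₀ hε hv

/-- `|w|⁻¹ ≥ ε⁻¹` where `0 < |w| ≤ ε`. [folklore] -/
theorem inv_le_newton {v : Fin 4 → ℝ} {ε : ℝ} (hv0 : 0 < spRad v) (hv : spRad v ≤ ε) : ε⁻¹ ≤ newton v :=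
  inv_anti₀ hv0 hv

end Literature.Probability.Process

end
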